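import Summits.CriticalPhenomena.Ising3D.ExclusionSentences

/-!
# Exclusion sentences for the classical exponent coordinates `β`, `γ` (cell `pub-ising3x`, recog-1)

HONEST FRAMING: lottery ticket; floor = tightest certified 3D Ising CFT bounds; no exact-solution
claim without a proof.

Family `CLASSIC` of the frozen list FAMILIES-v1 (`HOME/frozen/FAMILIES-v1.json` b39f709f…; SCOPE.md §3.1):
the historically conjectured closed forms for 3D Ising were stated for the thermodynamic exponents,
and under the standard scaling relations (`ν = 1/(d − Δ_ε)`, `η = 2Δ_σ − d + 2`, `β = ν Δ_σ`,
`γ = ν (d − 2Δ_σ)`, `d = 3`) the two that are NOT in bijection with a single datum are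
`β = Δ_σ/(3 − Δ_ε)` and `γ = (3 − 2Δ_σ)/(3 − Δ_ε)` (`ν, η, α, δ` are rational iff `Δ_ε` resp. `Δ_σ`
is, so their sentences are the RAT sentences of `ExclusionSentences.lean`). A certified box
`[a, b] × [c, d] ∋ (Δ_σ, Δ_ε)` maps monotonically onto the intervals
`β ∈ [a/(3 − c), b/(3 − d)]`, `γ ∈ [(3 − 2b)/(3 − c), (3 − 2a)/(3 − d)]` (`0 ≤ a`, `b ≤ 3/2`, `d < 3`),
on which `ratExcluded` decides "no rational of denominator `≤ Q` except …". This file proves the two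
monotonicity lemmas and the resulting sentences under `IsingEnclosure W R`:
`beta_ne_rat_of_isingEnclosure`, `gamma_ne_rat_of_isingEnclosure` — the kernel form of lines such as
"`β ≠ 5/16` (Essam–Fisher 1963), `β ≠ 3/8` (Zhang 2007), `γ ≠ 5/4` (Domb–Sykes 1961)" once a
certified `R` is in the tree (none is in phase 0; nothing here uses a 3D digit).
-/

namespace Summit.CriticalPhenomena.Ising3D

open Literature.MathematicalPhysics.QuantumFieldTheory.ConformalBootstrap3D

/-- `β`-coordinate of a point `(Δ_σ, Δ_ε) = (x, y)` in `d = 3`: `β = Δ_σ/(3 − Δ_ε)` (`= ν Δ_σ` under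
the scaling relations; the order-parameter exponent the series-era conjectures were stated for). -/
noncomputable def betaOf (x y : ℝ) : ℝ := x / (3 - y)

/-- `γ`-coordinate of `(Δ_σ, Δ_ε) = (x, y)` in `d = 3`: `γ = (3 − 2Δ_σ)/(3 − Δ_ε)` (`= ν (2 − η)`). -/
noncomputable def gammaOf (x y : ℝ) : ℝ := (3 - 2 * x) / (3 - y)

/-- Monotone image of a box under `β`: if `a ≤ x ≤ b`, `c ≤ y ≤ d` with `0 ≤ a` and `d < 3` then
`a/(3 − c) ≤ β(x, y) ≤ b/(3 − d)`. -/
theorem betaOf_mem_Icc {x y : ℝ} {a b c d : ℚ} (hx : (a : ℝ) ≤ x ∧ x ≤ b)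
    (hy : (c : ℝ) ≤ y ∧ y ≤ d) (ha : 0 ≤ a) (hd : d < 3) :
    ((a / (3 - c) : ℚ) : ℝ) ≤ betaOf x y ∧ betaOf x y ≤ ((b / (3 - d) : ℚ) : ℝ) := by
  have ha' : (0 : ℝ) ≤ a := by exact_mod_cast ha
  have hd' : (d : ℝ) < 3 := by exact_mod_cast hd
  have h3y : 0 < 3 - y := by linarith [hy.2]
  have h3d : 0 < 3 - (d : ℝ) := by linarith
  have hb' : (0 : ℝ) ≤ b := ha'.trans (hx.1.trans hx.2)
  unfold betaOf
  push_cast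
  constructor
  · calc (a : ℝ) / (3 - c) ≤ a / (3 - y) := div_le_div_of_nonneg_left ha' h3y (by linarith [hy.1])
      _ ≤ x / (3 - y) := div_le_div_of_nonneg_right hx.1 h3y.le
  · calc x / (3 - y) ≤ b / (3 - y) := div_le_div_of_nonneg_right hx.2 h3y.le
      _ ≤ b / (3 - d) := div_le_div_of_nonneg_left hb' h3d (by linarith [hy.2])

/-- Monotone image of a box under `γ`: if `a ≤ x ≤ b`, `c ≤ y ≤ d` with `b ≤ 3/2` and `d < 3` then
`(3 − 2b)/(3 − c) ≤ γ(x, y) ≤ (3 − 2a)/(3 − d)`. -/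
theorem gammaOf_mem_Icc {x y : ℝ} {a b c d : ℚ} (hx : (a : ℝ) ≤ x ∧ x ≤ b)
    (hy : (c : ℝ) ≤ y ∧ y ≤ d) (hb : b ≤ 3 / 2) (hd : d < 3) :
    (((3 - 2 * b) / (3 - c) : ℚ) : ℝ) ≤ gammaOf x y ∧
      gammaOf x y ≤ (((3 - 2 * a) / (3 - d) : ℚ) : ℝ) := by
  have hb' : (b : ℝ) ≤ 3 / 2 := by
    rw [show (3 / 2 : ℝ) = ((3 / 2 : ℚ) : ℝ) by norm_num]; exact_mod_cast hb
  have hd' : (d : ℝ) < 3 := by exact_mod_cast hd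
  have h3y : 0 < 3 - y := by linarith [hy.2]
  have h3d : 0 < 3 - (d : ℝ) := by linarith
  have hnb : (0 : ℝ) ≤ 3 - 2 * b := by linarith
  have hna : (0 : ℝ) ≤ 3 - 2 * a := by linarith [hx.1, hx.2]
  unfold gammaOf
  push_cast
  constructor
  · calc ((3 : ℝ) - 2 * b) / (3 - c) ≤ (3 - 2 * b) / (3 - y) :=
          div_le_div_of_nonneg_left hnb h3y (by linarith [hy.1])
      _ ≤ (3 - 2 * x) / (3 - y) := div_le_div_of_nonneg_right (by linarith [hx.2]) h3y.le
  · calc (3 - 2 * x) / (3 - y) ≤ (3 - 2 * a) / (3 - y) :=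
          div_le_div_of_nonneg_right (by linarith [hx.1]) h3y.le
      _ ≤ (3 - 2 * a) / (3 - d) := div_le_div_of_nonneg_left hna h3d (by linarith [hy.2])

/-- **CLASSIC sentence for `β`.** Under `IsingEnclosure W R` with `R` inside the rational box
`[a, b] × [c, d]` (`0 ≤ a`, `d < 3`): if `ratExcluded Q (a/(3−c)) (b/(3−d)) ex = true` then for every
admissible datum in the window, `β = Δ_σ/(3 − Δ_ε)` is no rational of denominator `≤ Q` outside `ex`. -/
theorem beta_ne_rat_of_isingEnclosure {W R : Set (ℝ × ℝ)} (h : IsingEnclosure W R) {a b c d : ℚ}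
    (hR : ∀ q ∈ R, ((a : ℝ) ≤ q.1 ∧ q.1 ≤ b) ∧ ((c : ℝ) ≤ q.2 ∧ q.2 ≤ d)) (ha : 0 ≤ a)
    (hd : d < 3) {Q : ℕ} {ex : List ℚ} (hx : ratExcluded Q (a / (3 - c)) (b / (3 - d)) ex = true)
    (D : SigmaEpsilonData) (hD : D.SatisfiesBootstrapAxioms) (hW : (D.Δσ, D.Δε) ∈ W) (r : ℚ)
    (hden : r.den ≤ Q) (hr : r ∉ ex) : betaOf D.Δσ D.Δε ≠ (r : ℝ) :=
  have hq := hR _ (h D hD hW)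
  ne_rat_of_ratExcluded hx (betaOf_mem_Icc hq.1 hq.2 ha hd) r hden hr

/-- **CLASSIC sentence for `γ`.** Under `IsingEnclosure W R` with `R` inside `[a, b] × [c, d]`
(`b ≤ 3/2`, `d < 3`): if `ratExcluded Q ((3−2b)/(3−c)) ((3−2a)/(3−d)) ex = true` then for every
admissible datum in the window, `γ = (3 − 2Δ_σ)/(3 − Δ_ε)` is no rational of denominator `≤ Q`
outside `ex`. -/
theorem gamma_ne_rat_of_isingEnclosure {W R : Set (ℝ × ℝ)} (h : IsingEnclosure W R) {a b c d : ℚ}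
    (hR : ∀ q ∈ R, ((a : ℝ) ≤ q.1 ∧ q.1 ≤ b) ∧ ((c : ℝ) ≤ q.2 ∧ q.2 ≤ d)) (hb : b ≤ 3 / 2)
    (hd : d < 3) {Q : ℕ} {ex : List ℚ}
    (hx : ratExcluded Q ((3 - 2 * b) / (3 - c)) ((3 - 2 * a) / (3 - d)) ex = true)
    (D : SigmaEpsilonData) (hD : D.SatisfiesBootstrapAxioms) (hW : (D.Δσ, D.Δε) ∈ W) (r : ℚ)
    (hden : r.den ≤ Q) (hr : r ∉ ex) : gammaOf D.Δσ D.Δε ≠ (r : ℝ) :=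
  have hq := hR _ (h D hD hW)
  ne_rat_of_ratExcluded hx (gammaOf_mem_Icc hq.1 hq.2 hb hd) r hden hr

end Summit.CriticalPhenomena.Ising3D
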